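import Summits.QuantumFields.YangMills.Theorems.AtomicSynthesisMolliCore
import Summits.QuantumFields.YangMills.Theorems.AtomicSynthesisRiemannDisc
import Mathlib
import HarnessLib

/-!
# AtomicSynthesis (stmt-QuantumFields-28126), stub `stub_singleSlot`: H4a `MolliApprox b N` PROVED (all `N`), and the registered stub
# `stub_singleSlot : StubSingleSlotP` assembled (H1 ✓`momentKilling` + H4a here + H4b ✓`riemannDisc_six` + H5/H4-split ✓`stubSingleSlot_of_split`)

H4a (planner ym-idea-11 g14's reduction, defs ✓`AtomicSynthesisSingleSlotReduction`): for the normalised finite-combination kernel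
`K = combKernel b w u` of a compactly supported Schwartz profile with vanishing moments of orders `1 … N−1`, smoothing at scale `τ ≤ σ`
reproduces a `C^N`-controlled `f` up to `C₁ (τ/σ)^N A/τ^m` in the `m`-th derivative — the instance `K := combKernel b w u` of the
def-free core ✓`AtomicSynthesisMolli.molliApprox_core` (Taylor along lines + vector-valued moment lemma + Leibniz' rule); conjunct (i)
(`kSmooth` is `C^∞`) because `kSmooth K τ f = K_τ ⋆ f` with `K_τ` smooth of compact support (Mathlib `HasCompactSupport.contDiff_convolution_left`;
planner's `g14/molliHelpers.lean`).  With w4 g22's ✓`riemannDisc_six` (H4b), ✓`momentKilling` (H1) and ✓`stubSingleSlot_of_split`, the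
REGISTERED STUB `stub_singleSlot` of crux AtomicSynthesis ⟨28126⟩ (= `StubSingleSlotP`, also the single-slot input of LINES «FemtoWitness»
23138 / twin 22956) follows BY NAME.

Mathlib + tree only; no `sorry`; standard axioms.  HONEST FRAMING: classical approximation theory (fixed-father-bump atomic synthesis on `ℝ⁴`);
`stub_tensorisation` of 28126, the cruxes 23138 / 22956 / 28126 themselves, every rung and summit statement are untouched; the Yang–Mills
mass gap is NOT proved.  Width seat `ym-line-sfw-p2-w3` g36 (cell ym-idea-1, free hands), `--supports stmt-QuantumFields-28126`.
-/

set_option autoImplicit false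

noncomputable section

open scoped BigOperators Topology ContDiff Convolution
open MeasureTheory Filter Metric ContinuousLinearMap
open Summit.QuantumFields.YangMills.Theorems.AtomicSynthesisMolli (molliApprox_core convolution_scaled_apply)
open Summit.QuantumFields.YangMills.Theorems.RPOnsetFloorPosTimeSynthCollar (SlotSynth)

namespace Summit.QuantumFields.YangMills.Cruxes.AtomicSynthesis.SingleSlotPlan

/-! ## Kernel facts for the finite-combination kernel of a compactly supported Schwartz profile
(adapted from planner ym-idea-11 g14's `g14/molliHelpers.lean`) -/

/-- The finite-combination kernel is smooth. -/
theorem contDiff_combKernel (b : SchwartzMap E4 ℝ) {J₀ : ℕ} (w : Fin J₀ → ℝ) (u : Fin J₀ → E4) {n : WithTop ℕ∞}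
    (hn : n ≤ ∞) : ContDiff ℝ n (combKernel b w u) := by
  unfold combKernel
  refine ContDiff.sum fun j _ => contDiff_const.mul ?_
  exact ((b.smooth ⊤).of_le hn).comp ((contDiff_id.sub contDiff_const).of_le le_top)

/-- The finite-combination kernel is continuous. -/
theorem continuous_combKernel (b : SchwartzMap E4 ℝ) {J₀ : ℕ} (w : Fin J₀ → ℝ) (u : Fin J₀ → E4) :
    Continuous (combKernel b w u) :=
  (contDiff_combKernel b w u (le_refl _)).continuous

/-- The finite-combination kernel of a compactly supported profile has compact support. -/
theorem hasCompactSupport_combKernel (b : SchwartzMap E4 ℝ) (hb : HasCompactSupport (b : E4 → ℝ)) {J₀ : ℕ}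
    (w : Fin J₀ → ℝ) (u : Fin J₀ → E4) : HasCompactSupport (combKernel b w u) := by
  have : combKernel b w u = fun v => ∑ j ∈ Finset.univ, (fun j v => w j * b (v - u j)) j v := by
    funext v; simp [combKernel]
  rw [this]
  classical
  refine Finset.induction_on (Finset.univ : Finset (Fin J₀)) ?_ ?_
  · simp only [Finset.sum_empty]; exact HasCompactSupport.zero
  · intro a s ha ih
    have h1 : (fun v => ∑ j ∈ insert a s, (fun j v => w j * b (v - u j)) j v) =
        (fun v => w a * b (v - u a)) + fun v => ∑ j ∈ s, (fun j v => w j * b (v - u j)) j v := by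
      funext v; simp [Finset.sum_insert ha]
    rw [h1]
    exact ((hb.comp_homeomorph (Homeomorph.subRight (u a))).mul_left).add ih

/-- The smoothing against a scaled smooth compactly supported kernel is smooth (for continuous `f`): it is the convolution
`K_τ ⋆ f` (`AtomicSynthesisMolli.convolution_scaled_apply`, Mathlib `HasCompactSupport.contDiff_convolution_left`). -/
theorem contDiff_kSmooth (K : E4 → ℝ) (hKd : ContDiff ℝ ∞ K) (hK : HasCompactSupport K) {τ : ℝ} (hτ : τ ≠ 0)
    (f : E4 → ℝ) (hf : Continuous f) : ContDiff ℝ ∞ (kSmooth K τ f) := by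
  have h : kSmooth K τ f = ((fun w : E4 => (τ ^ 4)⁻¹ * K (τ⁻¹ • w)) ⋆[lsmul ℝ ℝ, volume] f) := by
    funext x; rw [convolution_scaled_apply]; rfl
  rw [h]
  have hKτ : HasCompactSupport fun w : E4 => (τ ^ 4)⁻¹ * K (τ⁻¹ • w) := (hK.comp_smul (inv_ne_zero hτ)).mul_left
  have hKτd : ContDiff ℝ ∞ fun w : E4 => (τ ^ 4)⁻¹ * K (τ⁻¹ • w) :=
    contDiff_const.mul (hKd.comp ((contDiff_id.const_smul τ⁻¹).of_le le_top))
  exact hKτ.contDiff_convolution_left (lsmul ℝ ℝ) hKτd hf.locallyIntegrable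

/-- ★ **H4a `MolliApprox b N` (all `N`).**  Mollification with vanishing moments: for the normalised finite-combination kernel of a
compactly supported Schwartz profile with vanishing moments of orders `1 … N−1`, smoothing at scale `τ ≤ σ` reproduces a `C^N`-controlled
`f` up to `C₁ (τ/σ)^N A/τ^m` in the `m`-th derivative, `C₁ = 2∫|K|(1+‖v‖)^N` (`AtomicSynthesisMolli.molliApprox_core`). [folklore] -/
theorem molliApprox (b : SchwartzMap E4 ℝ) (N : ℕ) : MolliApprox b N := by
  intro hb J₀ w u hK1 hmom
  obtain ⟨C₁, hC₁, h⟩ := molliApprox_core (combKernel b w u) (continuous_combKernel b w u) (hasCompactSupport_combKernel b hb w u)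
    hK1 hmom
  refine ⟨C₁, hC₁, fun f c ϱ σ A τ hf hτ hτσ hσϱ hA hsupp hbd => ⟨?_, ?_⟩⟩
  · exact contDiff_kSmooth _ (contDiff_combKernel b w u le_rfl) (hasCompactSupport_combKernel b hb w u) hτ.ne' f hf.continuous
  · intro m hm z
    exact h f c ϱ σ A τ hf hτ hτσ hσϱ hA hsupp hbd m hm z

/-- ★★ **The registered stub `stub_singleSlot` of crux AtomicSynthesis ⟨stmt-QuantumFields-28126⟩, BY NAME**: single-slot fixed-father-bump
atomic synthesis on `ℝ⁴` holds for every compactly supported Schwartz bump with non-zero integral — H1 (moment killing, w4-landed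
`momentKilling`), H4a (`molliApprox`, this file), H4b (`riemannDisc_six`, w4 g22) through the planner's sorry-free reduction
`stubSingleSlot_of_split` (H5 iteration + H4 split). [folklore] -/
theorem stub_singleSlot : ∀ (b : SchwartzMap E4 ℝ), HasCompactSupport b → (∫ y, b y) ≠ 0 →
      ∃ (C₁ : ℝ) (N₁ : ℕ), 0 ≤ C₁ ∧ SlotSynth b C₁ N₁ :=
  stubSingleSlot_of_split (fun b hb hI => momentKilling b hb hI 6) (fun b => molliApprox b 6) riemannDisc_six

end Summit.QuantumFields.YangMills.Cruxes.AtomicSynthesis.SingleSlotPlan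

end
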